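/-
Copyright (c) 2026 the pub-hodgecm-mathlib formalisation cell (harness21).  Prover seat hodgecm-mathlib-K2-defs1 (g6), Track B, h413 = `stmt-HodgeConjecture-24833`, route `HCCMUnconditional`,
deal (230) of dealer K2E1-plan (g7) 2026-09-04T12:32:24Z ((n1) of K2E1-p11 (g2) 12:25:59Z; census K2E2-p12 (g6) 12:33:34Z).
-/
import Literature.NumberTheory.Automorphic.UnitaryGroupAdelicProduct     -- ★ `adelicProdEquiv : G(𝔸) ≃ₜ* G_∞ × G(𝔸_f)`, `archToAdelic`, `finAdelicToAdelic`
import Literature.NumberTheory.Automorphic.UnitaryGroupLevelBasis       -- ★ `exists_finCongruenceLevel_subset`, `isOpen_finCongruenceLevel`, `isCompact_finCongruenceLevel`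
import HarnessLib

/-!
# `K2E1AdelicIdentityNeighbourhoodBasisU` — THE NEIGHBOURHOODS `ι(V_∞)·ι_f(K_f(𝔫))` OF `1` IN `U(J)(𝔸_F)`: every neighbourhood of `1` in `G(𝔸)` contains a set `ι(V_∞)·ι_f(K)` with `V_∞` an
# open neighbourhood of `1` in `G_∞` and `K = K_f(𝔫)` (or `U ∩ K_f(𝔫)`, `U` any open subgroup) an OPEN COMPACT subgroup of `G(𝔸_f)`; these sets are open and form a basis of `𝓝 1`

Cell `pub/hodgecm-mathlib`, crux H413 = `stmt-HodgeConjecture-24833`.  THEOREMS ONLY (no `def`, no `instance`, no notation, no named-fact hypothesis, no `sorry`); lane `--supports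
stmt-HodgeConjecture-24833 --as helper` (count-neutral).  Closes no socket.  Generic `(F, E, c, N, J)` — every unitary group `U(J)` of the tree's `AdelicGroupData`.

THE MATHEMATICS ([BorelJacquet1979, §4.1]; [PlatonovRapinchuk1994, §5.1]).  `G(𝔸) ≃ₜ* G_∞ × G(𝔸_f)` via `g ↦ (g_∞, g_f)` with inverse `(a, b) ↦ ι(a)·ι_f(b)` (★ `adelicProdEquiv`), so
`ι(V)·ι_f(U)` is the image of `V ×ˢ U` under a homeomorphism — open when `V, U` are (§1) — and `𝓝 1 = 𝓝 1 ×ˢ 𝓝 1` transported; the principal congruence levels `K_f(𝔫)`, `𝔫 ≠ 0`, are a basis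
of `𝓝 1` in `G(𝔸_f)` (★ `exists_finCongruenceLevel_subset`, open ★ `isOpen_finCongruenceLevel`, compact ★ `isCompact_finCongruenceLevel`), whence §2; intersecting with a given open
subgroup `U` keeps openness and compactness (§3, the form K2E1-p11's arch test-function file consumes: `U ≤ K′` with `ω|_U = 1`).
* §1 `image_archToAdelic_mul_image_finAdelicToAdelic_eq`, `isOpen_image_archToAdelic_mul_image_finAdelicToAdelic`.
* §2 **`exists_isOpen_arch_mul_finCongruenceLevel_subset`** (every `W ∈ 𝓝 1` contains some `ι(V)·ι_f(K_f(𝔫))`), **`nhds_one_hasBasis_arch_mul_finCongruenceLevel`**.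
* §3 `isOpen_inf_finCongruenceLevel`, `isCompact_inf_finCongruenceLevel`, **`exists_isOpen_arch_mul_inf_finCongruenceLevel_subset`**.
HONEST LABEL: HC_CM is proved only modulo the 7 printed citations (2 remaining named inputs: hLiu418 = `stmt-HodgeConjecture-24832`, h413 = `stmt-HodgeConjecture-24833`) until rung 0
closes; count-neutral helper, closes no socket.

## References
* [BorelJacquet1979] A. Borel, H. Jacquet, *Automorphic forms and automorphic representations*, Proc. Symp. Pure Math. 33.1 (1979), §4.1.
* [PlatonovRapinchuk1994] V. Platonov, A. Rapinchuk, *Algebraic Groups and Number Theory* (1994), §5.1.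
-/

set_option autoImplicit false
set_option linter.dupNamespace false  -- the mandated namespace repeats the summit's segment (`HodgeConjecture.HodgeConjecture`)

noncomputable section

open NumberField IsDedekindDomain Topology Filter Set
open scoped MatrixGroups Pointwise
open Literature.NumberTheory.Automorphic Literature.NumberTheory.Automorphic.UnitaryGroup AdelicGroupData

namespace Summit.HodgeConjecture.HodgeConjecture.Cruxes.H413.K2E1AdelicIdentityNeighbourhoodBasisU

variable {F E : Type} [Field F] [NumberField F] [Field E] [NumberField E] [Algebra F E] {c : E ≃ₐ[F] E} {N : ℕ} {J : Matrix (Fin N) (Fin N) E}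

/-! ## §1 `ι(V)·ι_f(U)` is the image of `V ×ˢ U` under `adelicProdEquiv.symm`; it is open when `V` and `U` are -/

/-- `ι(V)·ι_f(U) = adelicProdEquiv⁻¹(V ×ˢ U)` (★ `adelicProdEquiv_symm_apply`: `(a, b) ↦ ι(a)·ι_f(b)`). [cite: BorelJacquet1979, §4.1] -/
theorem image_archToAdelic_mul_image_finAdelicToAdelic_eq (V : Set (arch F E c N J)) (U : Set (finAdelic F E c N J)) :
    archToAdelic F E c N J '' V * finAdelicToAdelic F E c N J '' U = (adelicProdEquiv F E c N J).symm '' (V ×ˢ U) := by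
  ext g
  simp only [Set.mem_mul, Set.mem_image, Set.mem_prod, adelicProdEquiv_symm_apply, Prod.exists]
  constructor
  · rintro ⟨_, ⟨a, ha, rfl⟩, _, ⟨b, hb, rfl⟩, rfl⟩
    exact ⟨a, b, ⟨ha, hb⟩, rfl⟩
  · rintro ⟨a, b, ⟨ha, hb⟩, rfl⟩
    exact ⟨_, ⟨a, ha, rfl⟩, _, ⟨b, hb, rfl⟩, rfl⟩

/-- **`ι(V)·ι_f(U)` IS OPEN** for open `V ⊆ G_∞`, `U ⊆ G(𝔸_f)` (image of the open `V ×ˢ U` under the homeomorphism `adelicProdEquiv.symm`). [cite: BorelJacquet1979, §4.1] -/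
theorem isOpen_image_archToAdelic_mul_image_finAdelicToAdelic {V : Set (arch F E c N J)} (hV : IsOpen V) {U : Set (finAdelic F E c N J)} (hU : IsOpen U) :
    IsOpen (archToAdelic F E c N J '' V * finAdelicToAdelic F E c N J '' U) := by
  rw [image_archToAdelic_mul_image_finAdelicToAdelic_eq]
  exact (adelicProdEquiv F E c N J).toHomeomorph.symm.isOpenMap _ (hV.prod hU)

/-! ## §2 Every neighbourhood of `1` contains some `ι(V_∞)·ι_f(K_f(𝔫))`; these form a basis of `𝓝 1` -/

/-- **EVERY NEIGHBOURHOOD OF `1` IN `G(𝔸)` CONTAINS `ι(V_∞)·ι_f(K_f(𝔫))`** with `V_∞ ∋ 1` open in `G_∞` and `𝔫 ≠ 0` (so `K_f(𝔫)` is an open compact subgroup of `G(𝔸_f)`, ★ `isOpen_∕isCompact_finCongruenceLevel`):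
`(a, b) ↦ ι(a)ι_f(b)` is continuous with value `1` at `(1, 1)`, so the preimage of `W` is a product neighbourhood `A ×ˢ B`; shrink `A` to an open `V_∞` and `B` to a congruence level
(★ `exists_finCongruenceLevel_subset`). [cite: BorelJacquet1979, §4.1] [cite: PlatonovRapinchuk1994, §5.1] -/
theorem exists_isOpen_arch_mul_finCongruenceLevel_subset {W : Set (adelicGroupData F E c N J).Adelic} (hW : W ∈ 𝓝 (1 : (adelicGroupData F E c N J).Adelic)) :
    ∃ V : Set (arch F E c N J), IsOpen V ∧ (1 : arch F E c N J) ∈ V ∧ ∃ 𝔫 : Ideal (𝓞 E), 𝔫 ≠ 0 ∧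
      archToAdelic F E c N J '' V * finAdelicToAdelic F E c N J '' (finCongruenceLevel F E c N J 𝔫 : Set (finAdelic F E c N J)) ⊆ W := by
  have hcont : Continuous fun p : arch F E c N J × finAdelic F E c N J => archToAdelic F E c N J p.1 * finAdelicToAdelic F E c N J p.2 :=
    ((continuous_archToAdelic F E c N J).comp continuous_fst).mul ((continuous_finAdelicToAdelic F E c N J).comp continuous_snd)
  have hpre : (fun p : arch F E c N J × finAdelic F E c N J => archToAdelic F E c N J p.1 * finAdelicToAdelic F E c N J p.2) ⁻¹' W ∈
      𝓝 (1 : arch F E c N J × finAdelic F E c N J) := by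
    refine hcont.continuousAt.preimage_mem_nhds ?_
    show W ∈ 𝓝 (archToAdelic F E c N J (1 : arch F E c N J × finAdelic F E c N J).1 * finAdelicToAdelic F E c N J (1 : arch F E c N J × finAdelic F E c N J).2)
    rwa [Prod.fst_one, Prod.snd_one, map_one, map_one, mul_one]
  obtain ⟨A, hA, B, hB, hAB⟩ := mem_nhds_prod_iff.1 hpre
  obtain ⟨V, hVA, hVo, hV1⟩ := mem_nhds_iff.1 hA
  obtain ⟨𝔫, h𝔫, hsub⟩ := exists_finCongruenceLevel_subset hB
  refine ⟨V, hVo, hV1, 𝔫, h𝔫, ?_⟩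
  rw [image_archToAdelic_mul_image_finAdelicToAdelic_eq, Set.image_subset_iff]
  exact (Set.prod_mono hVA hsub).trans hAB

/-- **BASIS OF `𝓝 1` IN `G(𝔸)`**: the sets `ι(V)·ι_f(K_f(𝔫))`, `V ∋ 1` open in `G_∞`, `𝔫 ≠ 0`, form a basis of the neighbourhood filter of `1`. [cite: BorelJacquet1979, §4.1] [cite: PlatonovRapinchuk1994, §5.1] -/
theorem nhds_one_hasBasis_arch_mul_finCongruenceLevel :
    (𝓝 (1 : (adelicGroupData F E c N J).Adelic)).HasBasis (fun p : Set (arch F E c N J) × Ideal (𝓞 E) => IsOpen p.1 ∧ (1 : arch F E c N J) ∈ p.1 ∧ p.2 ≠ 0)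
      (fun p => archToAdelic F E c N J '' p.1 * finAdelicToAdelic F E c N J '' (finCongruenceLevel F E c N J p.2 : Set (finAdelic F E c N J))) := by
  refine Filter.hasBasis_iff.2 fun W => ⟨fun hW => ?_, fun ⟨p, ⟨hpo, hp1, hp𝔫⟩, hsub⟩ => ?_⟩
  · obtain ⟨V, hVo, hV1, 𝔫, h𝔫, hsub⟩ := exists_isOpen_arch_mul_finCongruenceLevel_subset hW
    exact ⟨(V, 𝔫), ⟨hVo, hV1, h𝔫⟩, hsub⟩
  · refine Filter.mem_of_superset ((isOpen_image_archToAdelic_mul_image_finAdelicToAdelic hpo (isOpen_finCongruenceLevel F E c N J hp𝔫)).mem_nhds ?_) hsub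
    exact ⟨_, ⟨1, hp1, rfl⟩, _, ⟨1, (finCongruenceLevel F E c N J p.2).one_mem, rfl⟩, by simp only [map_one, mul_one]⟩

/-! ## §3 With a prescribed open subgroup `U ≤ G(𝔸_f)`: the open compact subgroups `U ∩ K_f(𝔫)` -/

omit [NumberField F] in
/-- `U ∩ K_f(𝔫)` is open for an open subgroup `U` and `𝔫 ≠ 0`. [folklore] -/
theorem isOpen_inf_finCongruenceLevel {U : Subgroup (finAdelic F E c N J)} (hU : IsOpen (U : Set (finAdelic F E c N J))) {𝔫 : Ideal (𝓞 E)} (h𝔫 : 𝔫 ≠ 0) :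
    IsOpen ((U ⊓ finCongruenceLevel F E c N J 𝔫 : Subgroup (finAdelic F E c N J)) : Set (finAdelic F E c N J)) := by
  rw [Subgroup.coe_inf]
  exact hU.inter (isOpen_finCongruenceLevel F E c N J h𝔫)

omit [NumberField F] in
/-- `U ∩ K_f(𝔫)` is compact for an open subgroup `U` and `𝔫 ≠ 0` (an open subgroup is closed; closed subset of the compact `K_f(𝔫)`). [cite: PlatonovRapinchuk1994, §5.1] -/
theorem isCompact_inf_finCongruenceLevel {U : Subgroup (finAdelic F E c N J)} (hU : IsOpen (U : Set (finAdelic F E c N J))) {𝔫 : Ideal (𝓞 E)} (h𝔫 : 𝔫 ≠ 0) :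
    IsCompact ((U ⊓ finCongruenceLevel F E c N J 𝔫 : Subgroup (finAdelic F E c N J)) : Set (finAdelic F E c N J)) := by
  rw [Subgroup.coe_inf]
  exact (isCompact_finCongruenceLevel F E c N J h𝔫).inter_left (U.isClosed_of_isOpen hU)

/-- **THE FORM K2E1-p11 CONSUMES**: given an open subgroup `U ≤ G(𝔸_f)` (e.g. `U ≤ K′` with `ω|_U = 1`) and `W ∈ 𝓝 1` in `G(𝔸)`, there are an open `V_∞ ∋ 1` in `G_∞` and `𝔫 ≠ 0` with
`ι(V_∞)·ι_f(U ∩ K_f(𝔫)) ⊆ W` — and `U ∩ K_f(𝔫)` is an open compact subgroup contained in `U` (`isOpen_∕isCompact_inf_finCongruenceLevel`). [cite: BorelJacquet1979, §4.1] [cite: PlatonovRapinchuk1994, §5.1] -/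
theorem exists_isOpen_arch_mul_inf_finCongruenceLevel_subset (U : Subgroup (finAdelic F E c N J)) {W : Set (adelicGroupData F E c N J).Adelic}
    (hW : W ∈ 𝓝 (1 : (adelicGroupData F E c N J).Adelic)) :
    ∃ V : Set (arch F E c N J), IsOpen V ∧ (1 : arch F E c N J) ∈ V ∧ ∃ 𝔫 : Ideal (𝓞 E), 𝔫 ≠ 0 ∧
      archToAdelic F E c N J '' V * finAdelicToAdelic F E c N J '' ((U ⊓ finCongruenceLevel F E c N J 𝔫 : Subgroup (finAdelic F E c N J)) : Set (finAdelic F E c N J)) ⊆ W := by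
  obtain ⟨V, hVo, hV1, 𝔫, h𝔫, hsub⟩ := exists_isOpen_arch_mul_finCongruenceLevel_subset hW
  refine ⟨V, hVo, hV1, 𝔫, h𝔫, subset_trans (Set.mul_subset_mul_left (Set.image_mono fun b hb => ?_)) hsub⟩
  exact (Subgroup.mem_inf.1 hb).2

end Summit.HodgeConjecture.HodgeConjecture.Cruxes.H413.K2E1AdelicIdentityNeighbourhoodBasisU
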